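import Summits.NavierStokesRegularity.NavierStokesRegularity.Theorems.AxisymmetricExtremalityAxisymmetricKatoGlobalStubSeregin2020TypeIILemma22ExcisionBallCutoffs
import Summits.NavierStokesRegularity.NavierStokesRegularity.Theorems.AxisymmetricExtremalityAxisymmetricKatoGlobalStubSeregin2020TypeIILemma22DeGiorgiTools
import Summits.NavierStokesRegularity.NavierStokesRegularity.Theorems.AxisymmetricExtremalityAxisymmetricKatoGlobalStubSeregin2020TypeIILemma22SublevelEnergyTools
import HarnessLib

/-!
# Seregin 2020, Lemma 2.2 (after Nazarov–Uraltseva 2012), piece L22-B (the energy class across the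
# axis), step F3b.4: TOOLS for the excision errors (e2), (e3)

Helper toward the stub `stub_seregin2020TypeII` of the crux `AxisymmetricKatoGlobal` (Seregin 2020,
Thm 2.1 ⇐ Lemma 2.2 = N–U 2012 Lemma 4.2 in the class 𝒱), piece L22-B = the passage of the energy
inequality across the singular set `S ⊆ axis` (route P, kit `A1-L22B-F3`): the test function `Θ` is
multiplied by the product cut-off `∏_{i∈A}(1-ψᵢ)` of the active balls `B(xᵢ, 4rᵢ)` of a finite
parabolic cover of `S`; the drift and axis-drift error terms this produces are bounded in
`…Lemma22ExcisionDriftError` / `…Lemma22ExcisionAxisError` with the tools of this file: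

* `lintegral_enorm_le_cube_holder` — Hölder `(3, 3/2)` against `1`: `∫⁻_E |U| ≤ ‖U‖_{3,E} |E|^{2/3}`
  (also the ONE Hölder step per ball of the global accounting of (e2));
* `integrableOn_of_lintegral_cube_lt_top` — `L³` on a set of finite measure is `L¹`;
* `norm_gradient_prodCut_sq_le`, `abs_fderiv_prodCut_sq_eR_le` —
  `|D(∏_{i∈A}(1-ψᵢ))²| ≤ 2 Σ_{i∈A} (C₀/rᵢ) 1_{B(xᵢ,4rᵢ)}`;
* `lintegral_inv_cylRadius_ballStep_le` — `∫∫_{[a,b]×B(x₀,ρ)} ϱ⁻¹ ≤ C (b-a) ρ²` for ANY centre.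

No Navier–Stokes statement is proved here.

## References

* A. I. Nazarov, N. N. Uraltseva, St. Petersburg Math. J. 23 (2012) 93–115 = arXiv:1011.1888,
  §4, Lemma 4.2 (the class with the singular drift `2x'/|x'|²`). [NazarovUraltseva2012]
* G. Seregin, Anal. Math. Phys. 10 (2020) 46 = arXiv:2006.04140, Lemma 2.2, class 𝒱 (the set `S`
  of parabolic Hausdorff dimension `≤ 1` on the axis). [Seregin2020]
-/

-- the problem directory repeats the summit name (D-0017); core's `dupNamespace` linter fires
set_option linter.dupNamespace false

noncomputable section

open MeasureTheory Set Function Filter Topology TopologicalSpace Metric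
open scoped NNReal ENNReal InnerProductSpace

namespace Summit.NavierStokesRegularity.NavierStokesRegularity.Theorems.AxisymmetricKatoGlobal.EulerScaling

open Literature.Analysis.FluidPDE Literature.Analysis.FluidPDE.Seregin2020

/-! ### Hölder and integrability of the drift -/

/-- **Hölder `(3, 3/2)` against `1`:** `∫⁻_E |U| ≤ (∫⁻_E |U|³)^{1/3} |E|^{2/3}`. [folklore] -/
theorem lintegral_enorm_le_cube_holder {E : Set (ℝ × EuclideanSpace ℝ (Fin 3))}
    {U : ℝ → EuclideanSpace ℝ (Fin 3) → EuclideanSpace ℝ (Fin 3)}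
    (hUm : AEStronglyMeasurable (uncurry U) volume) :
    ∫⁻ z in E, ‖U z.1 z.2‖ₑ ≤
      (∫⁻ z in E, ‖U z.1 z.2‖ₑ ^ (3 : ℕ)) ^ (1 / 3 : ℝ) * volume E ^ (2 / 3 : ℝ) := by
  have hf : AEMeasurable (fun z : ℝ × EuclideanSpace ℝ (Fin 3) => ‖U z.1 z.2‖ₑ) volume := hUm.enorm
  have h3 : (3 : ℝ).HolderConjugate (3 / 2) := by rw [Real.holderConjugate_iff]; norm_num
  have h := ENNReal.lintegral_mul_le_Lp_mul_Lq (volume.restrict E) h3 hf.restrict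
    (g := fun _ => 1) aemeasurable_const
  simp only [Pi.mul_apply, mul_one, ENNReal.one_rpow, lintegral_const, Measure.restrict_apply_univ,
    one_div, one_mul] at h
  rw [show ((3 : ℝ) / 2)⁻¹ = 2 / 3 by norm_num] at h
  have e : ∫⁻ z in E, ‖U z.1 z.2‖ₑ ^ (3 : ℝ) = ∫⁻ z in E, ‖U z.1 z.2‖ₑ ^ (3 : ℕ) :=
    lintegral_congr_ae (ae_of_all _ fun z => ENNReal.rpow_natCast _ 3)
  rw [e] at h
  simpa only [one_div] using h

/-- **`L³` on a set of finite measure is `L¹` there:** if `∫⁻_E |U|³ < ∞` and `|E| < ∞` then `U` is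
integrable on `E`. [folklore] -/
theorem integrableOn_of_lintegral_cube_lt_top {E : Set (ℝ × EuclideanSpace ℝ (Fin 3))}
    {U : ℝ → EuclideanSpace ℝ (Fin 3) → EuclideanSpace ℝ (Fin 3)}
    (hUm : AEStronglyMeasurable (uncurry U) volume)
    (hU3 : ∫⁻ z in E, ‖U z.1 z.2‖ₑ ^ (3 : ℕ) < ⊤) (hE : volume E ≠ ⊤) :
    IntegrableOn (fun z : ℝ × EuclideanSpace ℝ (Fin 3) => U z.1 z.2) E volume := by
  refine ⟨hUm.restrict, ?_⟩
  rw [hasFiniteIntegral_iff_enorm]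
  refine lt_of_le_of_lt (lintegral_enorm_le_cube_holder hUm) ?_
  refine ENNReal.mul_lt_top ?_ ?_
  · exact ENNReal.rpow_lt_top_of_nonneg (by norm_num) hU3.ne
  · exact ENNReal.rpow_lt_top_of_nonneg (by norm_num) hE

/-! ### The gradient of the squared product cut-off -/

/-- **`‖∇(∏_{i∈A}(1-ψᵢ))²(y)‖ ≤ 2 Σ_{i∈A} (C₀/rᵢ) 1_{B(xᵢ,4rᵢ)}(y)`** for `C¹` bumps `ψᵢ ∈ [0,1]` with
`‖Dψᵢ‖ ≤ C₀/rᵢ` and `Dψᵢ = 0` off `B(xᵢ, 4rᵢ)` (`∇P² = 2P∇P`, `|P| ≤ 1`, Leibniz). [folklore] -/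
theorem norm_gradient_prodCut_sq_le {A : Finset ℕ} {ψ : ℕ → EuclideanSpace ℝ (Fin 3) → ℝ}
    {x : ℕ → EuclideanSpace ℝ (Fin 3)} {r : ℕ → ℝ} {C₀ : ℝ}
    (hψ : ∀ i ∈ A, ContDiff ℝ 1 (ψ i)) (h01 : ∀ i ∈ A, ∀ y, 0 ≤ ψ i y ∧ ψ i y ≤ 1)
    (hD : ∀ i ∈ A, ∀ y, ‖fderiv ℝ (ψ i) y‖ ≤ C₀ / r i)
    (hD0 : ∀ i ∈ A, ∀ y, y ∉ ball (x i) (4 * r i) → fderiv ℝ (ψ i) y = 0)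
    (y : EuclideanSpace ℝ (Fin 3)) :
    ‖gradient (fun y => (∏ i ∈ A, (1 - ψ i y)) ^ 2) y‖ ≤
      2 * ∑ i ∈ A, C₀ / r i * (ball (x i) (4 * r i)).indicator (fun _ => (1 : ℝ)) y := by
  have hP : ContDiff ℝ 1 (fun y => ∏ i ∈ A, (1 - ψ i y)) := contDiff_prodCut hψ
  have h0 : ∀ i ∈ A, ∀ y, 0 ≤ ψ i y := fun i hi y => (h01 i hi y).1
  have h1 : ∀ i ∈ A, ∀ y, ψ i y ≤ 1 := fun i hi y => (h01 i hi y).2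
  have hPy0 : 0 ≤ ∏ i ∈ A, (1 - ψ i y) := prodCut_nonneg fun i hi => h1 i hi y
  have hPy1 : ∏ i ∈ A, (1 - ψ i y) ≤ 1 := prodCut_le_one (fun i hi => h0 i hi y) fun i hi => h1 i hi y
  have habs : |∏ i ∈ A, (1 - ψ i y)| ≤ 1 := abs_le.2 ⟨by linarith, hPy1⟩
  have hsum := norm_fderiv_prodCut_le hψ h0 h1 y
  have hterm : ∀ i ∈ A,
      ‖fderiv ℝ (ψ i) y‖ ≤ C₀ / r i * (ball (x i) (4 * r i)).indicator (fun _ => (1 : ℝ)) y := by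
    intro i hi
    by_cases hy : y ∈ ball (x i) (4 * r i)
    · rw [indicator_of_mem hy, mul_one]; exact hD i hi y
    · rw [hD0 i hi y hy, norm_zero, indicator_of_notMem hy, mul_zero]
  calc ‖gradient (fun y => (∏ i ∈ A, (1 - ψ i y)) ^ 2) y‖
      ≤ 2 * |∏ i ∈ A, (1 - ψ i y)| * ‖fderiv ℝ (fun y => ∏ i ∈ A, (1 - ψ i y)) y‖ :=
        norm_gradient_sq_le hP y
    _ ≤ 2 * 1 * ∑ i ∈ A, ‖fderiv ℝ (ψ i) y‖ :=
        mul_le_mul (mul_le_mul_of_nonneg_left habs zero_le_two) hsum (norm_nonneg _) (by norm_num)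
    _ ≤ 2 * 1 * ∑ i ∈ A, C₀ / r i * (ball (x i) (4 * r i)).indicator (fun _ => (1 : ℝ)) y := by
        gcongr with i hi
        exact hterm i hi
    _ = 2 * ∑ i ∈ A, C₀ / r i * (ball (x i) (4 * r i)).indicator (fun _ => (1 : ℝ)) y := by
        rw [mul_one]

/-- **`|D(∏_{i∈A}(1-ψᵢ))²(y)·e_ϱ(y)| ≤ 2 Σ_{i∈A} (C₀/rᵢ) 1_{B(xᵢ,4rᵢ)}(y)`** (same, with `|e_ϱ| ≤ 1`).
[folklore] -/
theorem abs_fderiv_prodCut_sq_eR_le {A : Finset ℕ} {ψ : ℕ → EuclideanSpace ℝ (Fin 3) → ℝ}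
    {x : ℕ → EuclideanSpace ℝ (Fin 3)} {r : ℕ → ℝ} {C₀ : ℝ}
    (hψ : ∀ i ∈ A, ContDiff ℝ 1 (ψ i)) (h01 : ∀ i ∈ A, ∀ y, 0 ≤ ψ i y ∧ ψ i y ≤ 1)
    (hD : ∀ i ∈ A, ∀ y, ‖fderiv ℝ (ψ i) y‖ ≤ C₀ / r i)
    (hD0 : ∀ i ∈ A, ∀ y, y ∉ ball (x i) (4 * r i) → fderiv ℝ (ψ i) y = 0)
    (y : EuclideanSpace ℝ (Fin 3)) :
    |fderiv ℝ (fun y => (∏ i ∈ A, (1 - ψ i y)) ^ 2) y (eR y)| ≤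
      2 * ∑ i ∈ A, C₀ / r i * (ball (x i) (4 * r i)).indicator (fun _ => (1 : ℝ)) y := by
  have hP : ContDiff ℝ 1 (fun y => ∏ i ∈ A, (1 - ψ i y)) := contDiff_prodCut hψ
  have h := norm_gradient_prodCut_sq_le hψ h01 hD hD0 y
  rw [norm_gradient_eq_norm_fderiv] at h
  calc |fderiv ℝ (fun y => (∏ i ∈ A, (1 - ψ i y)) ^ 2) y (eR y)|
      = ‖fderiv ℝ (fun y => (∏ i ∈ A, (1 - ψ i y)) ^ 2) y (eR y)‖ := (Real.norm_eq_abs _).symm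
    _ ≤ ‖fderiv ℝ (fun y => (∏ i ∈ A, (1 - ψ i y)) ^ 2) y‖ * ‖eR y‖ :=
        ContinuousLinearMap.le_opNorm _ _
    _ ≤ (2 * ∑ i ∈ A, C₀ / r i * (ball (x i) (4 * r i)).indicator (fun _ => (1 : ℝ)) y) * 1 :=
        mul_le_mul h (norm_eR_le_one _) (norm_nonneg _)
          ((norm_nonneg _).trans h)
    _ = 2 * ∑ i ∈ A, C₀ / r i * (ball (x i) (4 * r i)).indicator (fun _ => (1 : ℝ)) y := mul_one _

/-! ### `∫∫ ϱ⁻¹` over a time step times a ball (any centre) -/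

/-- **`∫∫_{[a,b]×B(x₀,ρ)} |x'|⁻¹ ≤ C (b - a) ρ²` for EVERY centre `x₀`** (Tonelli and
`lintegral_inv_cylRadius_rpow_ball_le` with `q = 1`; the version of
`lintegral_inv_cylRadius_cylinder_le` for balls off the origin, as needed for the excised balls of a
cover of `S`). [cite: NazarovUraltseva2012, §4 before Thm 4.1 (2x'/|x'|² ∈ L_{q,∞,loc}, q < 2)] -/
theorem lintegral_inv_cylRadius_ballStep_le : ∃ C : ℝ≥0, ∀ (a b : ℝ)
    (x₀ : EuclideanSpace ℝ (Fin 3)) (ρ : ℝ), a ≤ b → 0 < ρ →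
    ∫⁻ z in Icc a b ×ˢ ball x₀ ρ, ENNReal.ofReal ((cylRadius z.2)⁻¹)
      ≤ (C : ℝ≥0∞) * ENNReal.ofReal ((b - a) * ρ ^ 2) := by
  obtain ⟨C, hC⟩ := lintegral_inv_cylRadius_rpow_ball_le 1 zero_le_one one_lt_two
  refine ⟨C, fun a b x₀ ρ hab hρ => ?_⟩
  have hball := hC x₀ ρ hρ
  rw [Measure.volume_eq_prod, ← Measure.prod_restrict]
  refine (lintegral_prod_le _).trans ?_
  have hinner : ∀ t : ℝ, ∫⁻ y in ball x₀ ρ,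
      ENNReal.ofReal ((cylRadius ((t, y) : ℝ × EuclideanSpace ℝ (Fin 3)).2)⁻¹)
        ≤ (C : ℝ≥0∞) * ENNReal.ofReal (ρ ^ 2) := by
    intro t
    refine le_trans (le_of_eq ?_) (hball.trans_eq ?_)
    · refine lintegral_congr_ae (ae_of_all _ fun y => ?_)
      simp only [Real.rpow_neg_one]
    · norm_num
  calc ∫⁻ t in Icc a b, ∫⁻ y in ball x₀ ρ,
        ENNReal.ofReal ((cylRadius ((t, y) : ℝ × EuclideanSpace ℝ (Fin 3)).2)⁻¹)
      ≤ ∫⁻ _ in Icc a b, (C : ℝ≥0∞) * ENNReal.ofReal (ρ ^ 2) := lintegral_mono fun t => hinner t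
    _ = (C : ℝ≥0∞) * ENNReal.ofReal (ρ ^ 2) * volume (Icc a b) := setLIntegral_const _ _
    _ = (C : ℝ≥0∞) * ENNReal.ofReal ((b - a) * ρ ^ 2) := by
        rw [Real.volume_Icc, mul_assoc, ← ENNReal.ofReal_mul (by positivity), mul_comm (ρ ^ 2)]

end Summit.NavierStokesRegularity.NavierStokesRegularity.Theorems.AxisymmetricKatoGlobal.EulerScaling

end
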